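import Mathlib.Analysis.InnerProductSpace.Calculus
import Mathlib.MeasureTheory.Measure.Haar.InnerProductSpace
import Literature.MathematicalPhysics.QuantumLattice.YangMillsHeatFlowProofs
import Literature.MathematicalPhysics.QuantumLattice.LatticeWilsonFlow
import Literature.Analysis.Calculus.PeriodicDivergence
import HarnessLib

/-!
# The global energy identity for the Yang–Mills heat flow on the flat torus

Step (S2) of the published proof behind the named fact
`Literature.MathematicalPhysics.QuantumLattice.Waldron2019_yangMillsFlow_flatTorus` (Waldron 2019,
Cor. 1.2: global smooth solutions of the Yang–Mills heat flow on compact four-manifolds, here the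
flat torus `ℝ⁴/Lℤ⁴`): Waldron's §2 derives the pointwise identity
`½ ∂ₜ |F|² + |D^*F|² = ∇ⁱ∇ʲ S_{ij}` ((2.4)) and, integrating, the energy identity (2.5); on a closed
manifold the divergence integrates to zero and one obtains the *global energy identity*
`YM(t₂) + ∫_{t₁}^{t₂} ‖D^*F‖² = YM(t₁)`, which is exactly hypothesis (1.1) of Waldron's
Thm. 1.1 ("Over a closed manifold, (1.1) is immediate from the global energy identity", p. 3).

We prove it for classical (jointly `C²`) `L`-periodic `𝔲(N)`-valued solutions on `ℝ^{k+1}`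
(coefficients `M_N(ℂ)` with the Frobenius = Hilbert–Schmidt norm, the setting of the named fact),
with the tree's conventions `F = curvature`, `div_A F = divCurvature = −D_A^* F_A`,
`∂ₜ A = div_A F` (`IsYangMillsHeatFlow`):

* `frobenius_inner_lie_right` — `Ad`-invariance `⟨X, [a, Y]⟩ = −⟨[a, X], Y⟩` for `a ∈ 𝔲(N)`;
* `hasDerivAt_ymDensityOfBasis_slice` / `hasDerivAt_ymDensityOfBasis_of_flow` — the pointwise
  identity `∂ₜ ∑_{i<j}‖F_{ij}‖² = 2∑ᵢⱼ ∂ᵢ⟨F_{ij}, Ȧ_j⟩ − 2∑ⱼ ⟨(div_A F)_j, Ȧ_j⟩`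
  (`= … − 2∑ⱼ‖(div_A F)_j‖²` under the flow), Waldron (2.4);
* `setIntegral_cell_divergenceTerm_eq_zero` — the divergence term integrates to zero over a period
  cell (Stokes on the torus, via
  `Literature.Analysis.Calculus.integral_divergence_eq_zero_of_periodic`);
* `ymEnergy_cell_sub_eq_of_flow`, `IsYangMillsHeatFlow.ymEnergy_cell_sub_eq`,
  `IsYangMillsHeatFlow.ymEnergy_cell_antitone` — the global energy identity and monotonicity of the
  energy on a period cell, Waldron (2.5) with `χ ≡ 1` / hypothesis (1.1).
* `setIntegral_cell_weighted_divergenceTerm_eq`, `ymEnergy_cell_weighted_sub_eq_of_flow` — the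
  local (cut-off weighted) energy identity, Waldron (3.3) integrated in time;
* `IsYangMillsHeatFlow.dissipation_le_ymEnergy_cell` — hypothesis (1.1) of Waldron's Thm. 1.1:
  `2 ∫∫ |D^*F|² ≤ YM-energy of a period cell at the initial time`.

The real Hilbert–Schmidt inner product on `M_N(ℂ)` is the tree's `frobeniusInnerProductSpace`
(`LatticeWilsonFlow.lean`), activated locally. No definitions, no named facts.

References: A. Waldron, *Long-time existence for Yang–Mills flow*, Invent. Math. 217 (2019),
§1 (YM), (1.1), Thm. 1.1, Cor. 1.2; §2 (2.1)–(2.5) [Waldron2019]; M. Struwe, *The Yang–Mills flow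
in four dimensions*, Calc. Var. 2 (1994), §3.2, (12) [Struwe1994].
-/

noncomputable section

open scoped ContDiff Topology RealInnerProductSpace Matrix
open Set Filter MeasureTheory

namespace Literature.MathematicalPhysics.QuantumLattice

section MatrixEnergy

open scoped Matrix.Norms.Frobenius

attribute [local instance] frobeniusInnerProductSpace

variable {m : Type*} [Fintype m]

/-- **`Ad`-invariance of the Hilbert–Schmidt inner product** under `𝔲(N)`: for skew-adjoint `a`,
`⟨X, [a, Y]⟩ = −⟨[a, X], Y⟩` (`Re tr` is cyclic and `a† = −a`). [folklore] -/
theorem frobenius_inner_lie_right (a X Y : Matrix m m ℂ) (ha : star a = -a) :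
    ⟪X, ⁅a, Y⁆⟫ = -⟪⁅a, X⁆, Y⟫ := by
  have ha' : aᴴ = -a := by rw [← Matrix.star_eq_conjTranspose]; exact ha
  rw [frobenius_inner_def, frobenius_inner_def, Ring.lie_def, Ring.lie_def,
    Matrix.conjTranspose_sub, Matrix.conjTranspose_mul, Matrix.conjTranspose_mul, ha']
  simp only [Matrix.mul_sub, Matrix.sub_mul, Matrix.mul_neg, Matrix.neg_mul, Matrix.trace_sub,
    Matrix.trace_neg, Complex.sub_re, Complex.neg_re, Matrix.mul_assoc]
  rw [Matrix.trace_mul_comm a (Xᴴ * Y), Matrix.mul_assoc]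
  ring

variable [DecidableEq m]
variable {E : Type*} [NormedAddCommGroup E] [InnerProductSpace ℝ E]

/-- **Pointwise energy identity** (Waldron 2019 §2, (2.4)–(2.5) before integration). Let `A` be
jointly `C²` on positive space-time and `𝔲(N)`-valued at `(t, x)`, `t > 0`, and write
`Ȧ_w(y) = ∂ₜ A_w(t, y)`, `F_{ij} = F_{A(t)}(bᵢ, bⱼ)` in an orthonormal frame `b`. Then
`d/ds|ₛ₌ₜ ∑_{i<j} ‖F_{ij}(s, x)‖² = 2 ∑ᵢⱼ ∂ᵢ⟨F_{ij}, Ȧ_j⟩(x) − 2 ∑ⱼ ⟨∑ᵢ Dᵢ F_{ij}(x), Ȧ_j(x)⟩`: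
the time derivative of the energy density is a divergence minus twice the pairing of the
covariant divergence `div_A F` with `Ȧ` (which under (YM), `Ȧ = div_A F = −D^*F`, is
`−2 |D^* F|²`). Ingredients: `∂ₜ F = D Ȧ` (`hasDerivAt_curvature_slice`), the Leibniz rule for
`⟨·,·⟩` and `Ad`-invariance `⟨F, [A_i, Ȧ]⟩ = −⟨[A_i, F], Ȧ⟩` (`frobenius_inner_lie_right`).
[cite: Waldron2019, §2 (2.4)–(2.5)] -/
theorem hasDerivAt_ymDensityOfBasis_slice {ι : Type*} [Fintype ι] [LinearOrder ι]
    (b : OrthonormalBasis ι ℝ E) {n : WithTop ℕ∞} {A : ℝ → Connection E (Matrix m m ℂ)}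
    (hA : ContDiffOn ℝ n (fun p : ℝ × E => A p.1 p.2) (Ioi (0 : ℝ) ×ˢ (univ : Set E)))
    (hn : 2 ≤ n) {t : ℝ} (ht : 0 < t) (x : E)
    (hval : ∀ v, A t x v ∈ skewAdjoint.submodule ℝ (Matrix m m ℂ)) :
    HasDerivAt (fun s => ymDensityOfBasis b (A s) x)
      (2 * ∑ i, ∑ j, fderiv ℝ (fun y => ⟪curvature (A t) y (b i) (b j),
          fderiv ℝ (fun p : ℝ × E => A p.1 p.2) (t, y) ((1 : ℝ), (0 : E)) (b j)⟫) x (b i) -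
        2 * ∑ j, ⟪∑ i, covDeriv (A t) (fun y => curvature (A t) y (b i) (b j)) x (b i),
          fderiv ℝ (fun p : ℝ × E => A p.1 p.2) (t, x) ((1 : ℝ), (0 : E)) (b j)⟫) t := by
  set Ā := fun p : ℝ × E => A p.1 p.2 with hĀ
  have hU : IsOpen (Ioi (0 : ℝ) ×ˢ (univ : Set E)) := isOpen_Ioi.prod isOpen_univ
  have hp : (t, x) ∈ Ioi (0 : ℝ) ×ˢ (univ : Set E) := ⟨ht, mem_univ x⟩
  -- notation for the players at the point `x`
  set G : E → E → Matrix m m ℂ := fun y w => fderiv ℝ Ā (t, y) ((1 : ℝ), (0 : E)) w with hG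
  set F : ι → ι → Matrix m m ℂ := fun i j => curvature (A t) x (b i) (b j) with hF
  set DG : ι → ι → Matrix m m ℂ := fun i j => covDeriv (A t) (fun y => G y (b j)) x (b i) with hDG
  set DF : ι → ι → Matrix m m ℂ :=
    fun i j => covDeriv (A t) (fun y => curvature (A t) y (b i) (b j)) x (b i) with hDF
  set P : ι → ι → ℝ :=
    fun i j => fderiv ℝ (fun y => ⟪curvature (A t) y (b i) (b j), G y (b j)⟫) x (b i) with hP
  -- regularity of the slice and of the time derivative
  have hslice : ContDiff ℝ 2 (A t) := (contDiff_slice_of_contDiffOn hA ht).of_le hn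
  have hFdiff : ∀ i j, DifferentiableAt ℝ (fun y => curvature (A t) y (b i) (b j)) x :=
    fun i j => (differentiable_curvature_apply hslice (b i) (b j)) x
  have hGdiff : ∀ j, DifferentiableAt ℝ (fun y => G y (b j)) x := fun j =>
    (hasFDerivAt_timeDeriv_slice hU hA hn hp (b j)).differentiableAt
  -- Step 1: `d/ds ‖F_{ij}(s)‖² = 2 ⟨F_{ij}, D_i Ȧ_j - D_j Ȧ_i⟩`
  have hFij : ∀ i j, HasDerivAt (fun s => ‖curvature (A s) x (b i) (b j)‖ ^ 2)
      (2 * ⟪F i j, DG i j - DG j i⟫) t := fun i j =>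
    (hasDerivAt_curvature_slice hU hA hn hp (b i) (b j)).norm_sq
  -- Step 2: sum over the frame and halve
  have hsum : HasDerivAt (fun s => ymDensityOfBasis b (A s) x)
      ((∑ i, ∑ j, 2 * ⟪F i j, DG i j - DG j i⟫) / 2) t := by
    have heq : (fun s => ymDensityOfBasis b (A s) x) =
        fun s => (∑ i, ∑ j, ‖curvature (A s) x (b i) (b j)‖ ^ 2) / 2 :=
      funext fun s => ymDensityOfBasis_eq_half_sum b (A s) x
    rw [heq]
    exact (HasDerivAt.fun_sum fun i _ => HasDerivAt.fun_sum fun j _ => hFij i j).div_const 2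
  refine hsum.congr_deriv ?_
  -- Step 3: pointwise integration by parts in the frame direction `b i`
  have hkey : ∀ i j, ⟪F i j, DG i j⟫ = P i j - ⟪DF i j, G x (b j)⟫ := by
    intro i j
    have hleib := fderiv_inner_apply ℝ (hFdiff i j) (hGdiff j) (b i)
    have had := frobenius_inner_lie_right (A t x (b i)) (curvature (A t) x (b i) (b j)) (G x (b j))
      (skewAdjoint.mem_iff.mp (hval (b i)))
    simp only [hF, hDG, hDF, hP, covDeriv, inner_add_right, inner_add_left]
    rw [hleib, had]
    ring
  -- Step 4: antisymmetry `F_{ij} = -F_{ji}` doubles the first pairing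
  have hanti : ∑ i, ∑ j, ⟪F i j, DG j i⟫ = -∑ i, ∑ j, ⟪F i j, DG i j⟫ := by
    rw [Finset.sum_comm, ← Finset.sum_neg_distrib]
    refine Finset.sum_congr rfl fun i _ => ?_
    rw [← Finset.sum_neg_distrib]
    refine Finset.sum_congr rfl fun j _ => ?_
    simp only [hF]
    rw [curvature_antisymm (A t) x (b j) (b i), inner_neg_left]
  -- Step 5: bookkeeping
  have hdiv : ∑ i, ∑ j, ⟪F i j, DG i j⟫ = ∑ i, ∑ j, P i j - ∑ j, ⟪∑ i, DF i j, G x (b j)⟫ := by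
    simp_rw [hkey, Finset.sum_sub_distrib, sum_inner]
    rw [Finset.sum_comm (f := fun i j => ⟪DF i j, G x (b j)⟫)]
  have hfinal : (∑ i, ∑ j, 2 * ⟪F i j, DG i j - DG j i⟫) / 2 =
      ∑ i, ∑ j, ⟪F i j, DG i j⟫ - ∑ i, ∑ j, ⟪F i j, DG j i⟫ := by
    simp only [inner_sub_right, mul_sub, Finset.sum_sub_distrib, ← Finset.mul_sum]
    ring
  rw [hfinal, hanti, hdiv]
  ring

variable [FiniteDimensional ℝ E]

/-- **Pointwise energy identity along the flow.** Under the Yang–Mills heat equation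
`∂ₜ A = div_A F_A` at `(t, x)`, the time derivative of the energy density in the frame `b` is
`2 ∑ᵢⱼ ∂ᵢ⟨F_{ij}, Ȧ_j⟩(x) − 2 ∑ⱼ ‖div_A F(x)(bⱼ)‖²` — a divergence minus twice the dissipation
density `|D^*F|²`. Waldron (2019) §2, (2.4). [cite: Waldron2019, §2 (2.4)] -/
theorem hasDerivAt_ymDensityOfBasis_of_flow {ι : Type*} [Fintype ι] [LinearOrder ι]
    (b : OrthonormalBasis ι ℝ E) {n : WithTop ℕ∞} {A : ℝ → Connection E (Matrix m m ℂ)}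
    (hA : ContDiffOn ℝ n (fun p : ℝ × E => A p.1 p.2) (Ioi (0 : ℝ) ×ˢ (univ : Set E)))
    (hn : 2 ≤ n) {t : ℝ} (ht : 0 < t) (x : E)
    (hval : ∀ v, A t x v ∈ skewAdjoint.submodule ℝ (Matrix m m ℂ))
    (hpde : ∀ w, deriv (fun s => A s x w) t = divCurvature (A t) x w) :
    HasDerivAt (fun s => ymDensityOfBasis b (A s) x)
      (2 * ∑ i, ∑ j, fderiv ℝ (fun y => ⟪curvature (A t) y (b i) (b j),
          fderiv ℝ (fun p : ℝ × E => A p.1 p.2) (t, y) ((1 : ℝ), (0 : E)) (b j)⟫) x (b i) -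
        2 * ∑ j, ‖divCurvature (A t) x (b j)‖ ^ 2) t := by
  have hn0 : n ≠ 0 := by
    rintro rfl
    exact (not_le.mpr (by exact_mod_cast (by norm_num : (0:ℕ) < 2) : (0 : WithTop ℕ∞) < 2)) hn
  have h := hasDerivAt_ymDensityOfBasis_slice b hA hn ht x hval
  refine h.congr_deriv ?_
  congr 2
  refine Finset.sum_congr rfl fun j _ => ?_
  have hslice : ContDiff ℝ 2 (A t) := (contDiff_slice_of_contDiffOn hA ht).of_le hn
  have hG : fderiv ℝ (fun p : ℝ × E => A p.1 p.2) (t, x) ((1 : ℝ), (0 : E)) (b j) =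
      divCurvature (A t) x (b j) := by
    rw [← hpde (b j)]
    exact (deriv_slice_of_contDiffOn hA hn0 ht x (b j)).symm
  rw [← divCurvature_eq_sum_orthonormalBasis b (A t) hslice x (b j), hG,
    real_inner_self_eq_norm_sq]

omit [FiniteDimensional ℝ E] in
/-- The energy density `(s, y) ↦ ∑_{i<j} ‖F_{ij}(s, y)‖²` of a jointly `C^n`, `2 ≤ n`,
time-dependent connection is jointly `C¹` on positive space-time. [folklore] -/
theorem contDiffOn_ymDensityOfBasis_joint {ι : Type*} [Fintype ι] [LinearOrder ι]
    (b : OrthonormalBasis ι ℝ E) {n : WithTop ℕ∞} {A : ℝ → Connection E (Matrix m m ℂ)}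
    (hA : ContDiffOn ℝ n (fun p : ℝ × E => A p.1 p.2) (Ioi (0 : ℝ) ×ˢ (univ : Set E)))
    (hn : 2 ≤ n) :
    ContDiffOn ℝ 1 (fun p : ℝ × E => ymDensityOfBasis b (A p.1) p.2)
      (Ioi (0 : ℝ) ×ˢ (univ : Set E)) := by
  have heq : (fun p : ℝ × E => ymDensityOfBasis b (A p.1) p.2) =
      fun p => (∑ i, ∑ j, ‖curvature (A p.1) p.2 (b i) (b j)‖ ^ 2) / 2 :=
    funext fun p => ymDensityOfBasis_eq_half_sum b (A p.1) p.2
  rw [heq]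
  refine ContDiffOn.div_const (ContDiffOn.sum fun i _ => ContDiffOn.sum fun j _ => ?_) 2
  have h1 : ContDiffOn ℝ 1 (fun p : ℝ × E => curvature (A p.1) p.2 (b i) (b j))
      (Ioi (0 : ℝ) ×ˢ (univ : Set E)) :=
    contDiffOn_curvature_joint (isOpen_Ioi.prod isOpen_univ) hA
      (by rw [one_add_one_eq_two]; exact hn) (b i) (b j)
  exact h1.norm_sq ℝ

/-- **Joint continuity of the dissipative energy rate.** Along a jointly `C^n` (`2 ≤ n`),
`𝔲(N)`-valued solution of the Yang–Mills heat equation on positive space-time, the rate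
`2 ∑ᵢⱼ ∂ᵢ⟨F_{ij}, Ȧ_j⟩ − 2 ∑ⱼ ‖div_A F(bⱼ)‖²` is the partial time derivative of the `C¹` energy
density, hence jointly continuous. [folklore] -/
theorem continuousOn_energyRate_of_flow {ι : Type*} [Fintype ι] [LinearOrder ι]
    (b : OrthonormalBasis ι ℝ E) {n : WithTop ℕ∞} {A : ℝ → Connection E (Matrix m m ℂ)}
    (hA : ContDiffOn ℝ n (fun p : ℝ × E => A p.1 p.2) (Ioi (0 : ℝ) ×ˢ (univ : Set E)))
    (hn : 2 ≤ n)
    (hval : ∀ ⦃s : ℝ⦄, 0 < s → (A s).IsValuedIn (skewAdjoint.submodule ℝ (Matrix m m ℂ)))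
    (hpde : ∀ ⦃s : ℝ⦄, 0 < s → ∀ y w, deriv (fun s' => A s' y w) s = divCurvature (A s) y w) :
    ContinuousOn (fun p : ℝ × E =>
      2 * ∑ i, ∑ j, fderiv ℝ (fun y => ⟪curvature (A p.1) y (b i) (b j),
          fderiv ℝ (fun q : ℝ × E => A q.1 q.2) (p.1, y) ((1 : ℝ), (0 : E)) (b j)⟫) p.2 (b i) -
        2 * ∑ j, ‖divCurvature (A p.1) p.2 (b j)‖ ^ 2)
      (Ioi (0 : ℝ) ×ˢ (univ : Set E)) := by
  have hU : IsOpen (Ioi (0 : ℝ) ×ˢ (univ : Set E)) := isOpen_Ioi.prod isOpen_univ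
  set e : ℝ × E → ℝ := fun p => ymDensityOfBasis b (A p.1) p.2 with he
  have he1 : ContDiffOn ℝ 1 e (Ioi (0 : ℝ) ×ˢ (univ : Set E)) :=
    contDiffOn_ymDensityOfBasis_joint b hA hn
  -- the rate is the partial time derivative of `e`
  have hrate : ∀ p ∈ Ioi (0 : ℝ) ×ˢ (univ : Set E),
      2 * ∑ i, ∑ j, fderiv ℝ (fun y => ⟪curvature (A p.1) y (b i) (b j),
          fderiv ℝ (fun q : ℝ × E => A q.1 q.2) (p.1, y) ((1 : ℝ), (0 : E)) (b j)⟫) p.2 (b i) -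
        2 * ∑ j, ‖divCurvature (A p.1) p.2 (b j)‖ ^ 2 = fderiv ℝ e p ((1 : ℝ), (0 : E)) := by
    rintro ⟨s, y⟩ hp
    have h1 := hasDerivAt_ymDensityOfBasis_of_flow b hA hn hp.1 y (hval hp.1 y) (hpde hp.1 y)
    have h2 : HasDerivAt (fun s' => e (s', y)) (fderiv ℝ e (s, y) ((1 : ℝ), (0 : E))) s :=
      hasDerivAt_curry_of_contDiffOn hU he1 one_ne_zero hp
    exact h1.unique h2
  have hcont : ContinuousOn (fun p : ℝ × E => fderiv ℝ e p ((1 : ℝ), (0 : E)))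
      (Ioi (0 : ℝ) ×ˢ (univ : Set E)) :=
    ((ContinuousLinearMap.apply ℝ ℝ ((1 : ℝ), (0 : E))).continuous).comp_continuousOn
      (he1.continuousOn_fderiv_of_isOpen hU le_rfl)
  exact hcont.congr hrate

/-- Under the flow equation, `div_A F` is the time derivative read off the joint map, hence the
dissipation density `∑ⱼ ‖div_A F(bⱼ)‖²` is `∑ⱼ ‖DĀ[(1,0)] bⱼ‖²`. [folklore] -/
theorem norm_divCurvature_eq_of_flow {n : WithTop ℕ∞} {A : ℝ → Connection E (Matrix m m ℂ)}
    (hA : ContDiffOn ℝ n (fun p : ℝ × E => A p.1 p.2) (Ioi (0 : ℝ) ×ˢ (univ : Set E)))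
    (hn : n ≠ 0) {s : ℝ} (hs : 0 < s) (y w : E)
    (hpde : deriv (fun s' => A s' y w) s = divCurvature (A s) y w) :
    divCurvature (A s) y w =
      fderiv ℝ (fun p : ℝ × E => A p.1 p.2) (s, y) ((1 : ℝ), (0 : E)) w := by
  rw [← hpde]
  exact deriv_slice_of_contDiffOn hA hn hs y w

/-- **Joint continuity of the divergence term** `∑ᵢⱼ ∂ᵢ⟨F_{ij}, Ȧ_j⟩` along a `𝔲(N)`-valued
solution (it is half the energy rate plus the dissipation `∑ⱼ ‖Ȧ_j‖²`). [folklore] -/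
theorem continuousOn_divergenceTerm_of_flow {ι : Type*} [Fintype ι] [LinearOrder ι]
    (b : OrthonormalBasis ι ℝ E) {n : WithTop ℕ∞} {A : ℝ → Connection E (Matrix m m ℂ)}
    (hA : ContDiffOn ℝ n (fun p : ℝ × E => A p.1 p.2) (Ioi (0 : ℝ) ×ˢ (univ : Set E)))
    (hn : 2 ≤ n)
    (hval : ∀ ⦃s : ℝ⦄, 0 < s → (A s).IsValuedIn (skewAdjoint.submodule ℝ (Matrix m m ℂ)))
    (hpde : ∀ ⦃s : ℝ⦄, 0 < s → ∀ y w, deriv (fun s' => A s' y w) s = divCurvature (A s) y w) :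
    ContinuousOn (fun p : ℝ × E =>
      ∑ i, ∑ j, fderiv ℝ (fun y => ⟪curvature (A p.1) y (b i) (b j),
          fderiv ℝ (fun q : ℝ × E => A q.1 q.2) (p.1, y) ((1 : ℝ), (0 : E)) (b j)⟫) p.2 (b i))
      (Ioi (0 : ℝ) ×ˢ (univ : Set E)) := by
  have hU : IsOpen (Ioi (0 : ℝ) ×ˢ (univ : Set E)) := isOpen_Ioi.prod isOpen_univ
  have hn0 : n ≠ 0 := by
    rintro rfl
    exact (not_le.mpr (by exact_mod_cast (by norm_num : (0:ℕ) < 2) : (0 : WithTop ℕ∞) < 2)) hn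
  have hrate := continuousOn_energyRate_of_flow b hA hn hval hpde
  -- the dissipation in terms of the joint derivative is continuous
  have hG : ContinuousOn (fun p : ℝ × E =>
      ∑ j, ‖fderiv ℝ (fun q : ℝ × E => A q.1 q.2) p ((1 : ℝ), (0 : E)) (b j)‖ ^ 2)
      (Ioi (0 : ℝ) ×ˢ (univ : Set E)) := by
    have h1 := hA.continuousOn_fderiv_of_isOpen hU (ENat.one_le_iff_ne_zero_withTop.mpr hn0)
    refine continuousOn_finsetSum _ fun j _ => ?_
    exact (continuous_norm.comp_continuousOn
      ((h1.clm_apply continuousOn_const).clm_apply continuousOn_const)).pow 2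
  refine ((continuousOn_const (c := (2⁻¹ : ℝ))).mul
    (hrate.add ((continuousOn_const (c := (2 : ℝ))).mul hG))).congr ?_
  rintro ⟨s, y⟩ hp
  have hD : ∀ j, divCurvature (A s) y (b j) =
      fderiv ℝ (fun q : ℝ × E => A q.1 q.2) (s, y) ((1 : ℝ), (0 : E)) (b j) := fun j =>
    norm_divCurvature_eq_of_flow hA hn0 hp.1 y (b j) (hpde hp.1 y (b j))
  simp only [Pi.mul_apply, Pi.add_apply, ← hD]
  ring

end MatrixEnergy

section TorusEnergy

open scoped Matrix.Norms.Frobenius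

attribute [local instance] frobeniusInnerProductSpace

variable {m : Type*} [Fintype m] [DecidableEq m] {k : ℕ}

/-- **The divergence term integrates to zero over a period cell.** For an `L`-periodic (in every
lattice direction), jointly `C²` time-dependent connection on `ℝ^{k+1}` whose divergence term is
continuous, `∫_{cell} ∑ᵢⱼ ∂ᵢ⟨F_{ij}, Ȧ_j⟩ = 0` at each positive time: the field
`Wᵢ = ∑ⱼ ⟨F_{ij}, Ȧ_j⟩` is periodic and the face fluxes cancel (Stokes on the flat torus).
[folklore] -/
theorem setIntegral_cell_divergenceTerm_eq_zero {n : WithTop ℕ∞} {L : ℝ} (hL : 0 ≤ L)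
    (a : Fin (k + 1) → ℝ) {A : ℝ → Connection (EuclideanSpace ℝ (Fin (k + 1))) (Matrix m m ℂ)}
    (hA : ContDiffOn ℝ n (fun p : ℝ × _ => A p.1 p.2) (Ioi (0 : ℝ) ×ˢ univ))
    (hn : 2 ≤ n) {s : ℝ} (hs : 0 < s)
    (hper : ∀ s : ℝ, 0 < s → (A s).IsLatticePeriodic L)
    (hcont : Continuous fun y : EuclideanSpace ℝ (Fin (k + 1)) =>
      ∑ i, ∑ j, fderiv ℝ (fun z => ⟪curvature (A s) z (EuclideanSpace.basisFun _ ℝ i)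
          (EuclideanSpace.basisFun _ ℝ j),
        fderiv ℝ (fun q : ℝ × _ => A q.1 q.2) (s, z) ((1 : ℝ), 0)
          (EuclideanSpace.basisFun _ ℝ j)⟫) y (EuclideanSpace.basisFun _ ℝ i)) :
    ∫ y in {y | WithLp.ofLp y ∈ Icc a (fun i => a i + L)},
      ∑ i, ∑ j, fderiv ℝ (fun z => ⟪curvature (A s) z (EuclideanSpace.basisFun _ ℝ i)
          (EuclideanSpace.basisFun _ ℝ j),
        fderiv ℝ (fun q : ℝ × _ => A q.1 q.2) (s, z) ((1 : ℝ), 0)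
          (EuclideanSpace.basisFun _ ℝ j)⟫) y (EuclideanSpace.basisFun _ ℝ i) = 0 := by
  set 𝔟 := EuclideanSpace.basisFun (Fin (k + 1)) ℝ with h𝔟
  have hU : IsOpen (Ioi (0 : ℝ) ×ˢ (univ : Set (EuclideanSpace ℝ (Fin (k + 1))))) :=
    isOpen_Ioi.prod isOpen_univ
  have hn0 : n ≠ 0 := by
    rintro rfl
    exact (not_le.mpr (by exact_mod_cast (by norm_num : (0:ℕ) < 2) : (0 : WithTop ℕ∞) < 2)) hn
  -- the players at time `s`
  set G : (EuclideanSpace ℝ (Fin (k + 1))) → (EuclideanSpace ℝ (Fin (k + 1))) → Matrix m m ℂ :=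
    fun y w => fderiv ℝ (fun q : ℝ × _ => A q.1 q.2) (s, y) ((1 : ℝ), 0) w with hG
  set Φ : Fin (k + 1) → Fin (k + 1) → (EuclideanSpace ℝ (Fin (k + 1))) → ℝ :=
    fun i j y => ⟪curvature (A s) y (𝔟 i) (𝔟 j), G y (𝔟 j)⟫ with hΦ
  have hslice : ContDiff ℝ 2 (A s) := (contDiff_slice_of_contDiffOn hA hs).of_le hn
  have hFd : ∀ i j, Differentiable ℝ fun y => curvature (A s) y (𝔟 i) (𝔟 j) := fun i j =>
    differentiable_curvature_apply hslice _ _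
  have hGd : ∀ j, Differentiable ℝ fun y => G y (𝔟 j) := fun j y =>
    (hasFDerivAt_timeDeriv_slice hU hA hn ⟨hs, mem_univ y⟩ (𝔟 j)).differentiableAt
  have hΦd : ∀ i j, Differentiable ℝ (Φ i j) := fun i j => (hFd i j).inner ℝ (hGd j)
  -- the vector field `W i = ∑ j Φ i j` on `EuclideanSpace` and in coordinates
  set W : (EuclideanSpace ℝ (Fin (k + 1))) → Fin (k + 1) → ℝ := fun y i => ∑ j, Φ i j y with hW
  have hWd : Differentiable ℝ W :=
    differentiable_pi.mpr fun i => Differentiable.fun_sum fun j _ => hΦd i j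
  set w : (Fin (k + 1) → ℝ) → Fin (k + 1) → ℝ := fun z => W (WithLp.toLp 2 z) with hw
  have htoLp : Differentiable ℝ
      (fun z : Fin (k + 1) → ℝ => (WithLp.toLp 2 z : EuclideanSpace ℝ (Fin (k + 1)))) :=
    (PiLp.continuousLinearEquiv 2 ℝ (fun _ : Fin (k + 1) => ℝ)).symm.differentiable
  have hwd : Differentiable ℝ w := hWd.comp htoLp
  -- periodicity
  have hperA : ∀ i, ∀ r : ℝ, 0 < r → ∀ y : EuclideanSpace ℝ (Fin (k + 1)),
      A r (y + EuclideanSpace.single i L) = A r y :=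
    fun i r hr y => hper r hr y i
  have hΦper : ∀ i j l y, Φ i j (y + EuclideanSpace.single l L) = Φ i j y := by
    intro i j l y
    simp only [hΦ, hG, curvature_comp_add _ (hperA l s hs)]
    rw [fderiv_joint_comp_add _ (hperA l) hs]
  have hwper : ∀ z l, w (z + Pi.single l L) = w z := by
    intro z l
    simp only [hw, hW, WithLp.toLp_add, PiLp.toLp_single]
    funext i
    exact Finset.sum_congr rfl fun j _ => hΦper i j l _
  -- the divergence of `w` in coordinates is the divergence term
  set eqv := (PiLp.continuousLinearEquiv 2 ℝ (fun _ : Fin (k + 1) => ℝ)).symm with heqv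
  have hdiv : ∀ z : Fin (k + 1) → ℝ, ∑ i, fderiv ℝ w z (Pi.single i 1) i =
      ∑ i, ∑ j, fderiv ℝ (Φ i j) (WithLp.toLp 2 z) (𝔟 i) := by
    intro z
    refine Finset.sum_congr rfl fun i _ => ?_
    have hc : HasFDerivAt (fun z : Fin (k + 1) → ℝ => W (WithLp.toLp 2 z))
        ((fderiv ℝ W (WithLp.toLp 2 z)).comp
          (eqv : (Fin (k + 1) → ℝ) →L[ℝ] (EuclideanSpace ℝ (Fin (k + 1))))) z :=
      (hWd _).hasFDerivAt.comp z eqv.hasFDerivAt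
    have hWi : fderiv ℝ W (WithLp.toLp 2 z) = ContinuousLinearMap.pi fun i =>
        fderiv ℝ (fun y => ∑ j, Φ i j y) (WithLp.toLp 2 z) :=
      fderiv_pi fun i => (Differentiable.fun_sum fun j _ => hΦd i j) _
    rw [hw, hc.fderiv, ContinuousLinearMap.comp_apply, hWi, ContinuousLinearMap.pi_apply,
      fderiv_fun_sum fun j _ => (hΦd i j _)]
    simp [heqv, h𝔟, EuclideanSpace.basisFun_apply]
  -- integrability of the divergence on the period box
  have hint : IntegrableOn (fun z => ∑ i, fderiv ℝ w z (Pi.single i 1) i)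
      (Icc a (fun i => a i + L)) := by
    have hc : Continuous fun z : Fin (k + 1) → ℝ =>
        ∑ i, ∑ j, fderiv ℝ (Φ i j) (WithLp.toLp 2 z) (𝔟 i) := hcont.comp eqv.continuous
    rw [show (fun z => ∑ i, fderiv ℝ w z (Pi.single i 1) i) =
      fun z : Fin (k + 1) → ℝ => ∑ i, ∑ j, fderiv ℝ (Φ i j) (WithLp.toLp 2 z) (𝔟 i) from
      funext hdiv]
    exact hc.continuousOn.integrableOn_compact isCompact_Icc
  -- Stokes on the torus, in coordinates
  have hper0 := Literature.Analysis.Calculus.integral_divergence_eq_zero_of_periodic hL a w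
    (fun z => fderiv ℝ w z) hwd.continuous (fun z => (hwd z).hasFDerivAt) hwper hint
  simp_rw [hdiv] at hper0
  -- transport back to `EuclideanSpace`
  have htrans := (PiLp.volume_preserving_ofLp (Fin (k + 1))).setIntegral_preimage_emb
    (MeasurableEquiv.toLp 2 (Fin (k + 1) → ℝ)).symm.measurableEmbedding
    (fun z => ∑ i, ∑ j, fderiv ℝ (Φ i j) (WithLp.toLp 2 z) (𝔟 i)) (Icc a (fun i => a i + L))
  simp only [WithLp.toLp_ofLp] at htrans
  rw [hper0] at htrans
  exact htrans

/-- **Global energy identity for the Yang–Mills heat flow on the flat torus** (step (S2) of the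
proof of Waldron's Cor. 1.2: "over a closed manifold, (1.1) is immediate from the global energy
identity"). Let `A` be jointly `C^n` (`2 ≤ n`) on positive space-time, `L`-periodic in every
lattice direction, `𝔲(N)`-valued, and solve `∂ₜ A = div_A F_A = −D_A^* F_A` on `(0, ∞) × ℝ^{k+1}`.
Then on every period cell `Q = a + [0, L]^{k+1}` and for `0 < t₁ ≤ t₂`,
`∫_Q ∑_{i<j} ‖F_{ij}(t₂)‖² − ∫_Q ∑_{i<j} ‖F_{ij}(t₁)‖² = −2 ∫_{t₁}^{t₂} ∫_Q ∑ⱼ ‖(div_A F)_j‖²`,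
i.e. `YM(t₂) + ∫∫ |D^*F|² = YM(t₁)` with `YM = ½ ∫ |F|²` (Waldron 2019 (2.5) with `χ ≡ 1`;
Struwe 1994, §3.2, (12)). Proof: the pointwise identity `hasDerivAt_ymDensityOfBasis_of_flow`,
Stokes on the torus for the divergence term (`setIntegral_cell_divergenceTerm_eq_zero`), the
fundamental theorem of calculus in `t` and Fubini on `Q × [t₁, t₂]`.
[cite: Waldron2019, §2 (2.5)] -/
theorem ymEnergy_cell_sub_eq_of_flow {n : WithTop ℕ∞} {L : ℝ} (hL : 0 ≤ L)
    (a : Fin (k + 1) → ℝ) {A : ℝ → Connection (EuclideanSpace ℝ (Fin (k + 1))) (Matrix m m ℂ)}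
    (hA : ContDiffOn ℝ n (fun p : ℝ × _ => A p.1 p.2) (Ioi (0 : ℝ) ×ˢ univ))
    (hn : 2 ≤ n) (hper : ∀ s : ℝ, 0 < s → (A s).IsLatticePeriodic L)
    (hval : ∀ ⦃s : ℝ⦄, 0 < s → (A s).IsValuedIn (skewAdjoint.submodule ℝ (Matrix m m ℂ)))
    (hpde : ∀ ⦃s : ℝ⦄, 0 < s → ∀ y w, deriv (fun s' => A s' y w) s = divCurvature (A s) y w)
    {t₁ t₂ : ℝ} (ht₁ : 0 < t₁) (h12 : t₁ ≤ t₂) :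
    (∫ y in {y | WithLp.ofLp y ∈ Icc a (fun i => a i + L)},
        ymDensityOfBasis (EuclideanSpace.basisFun _ ℝ) (A t₂) y) -
      (∫ y in {y | WithLp.ofLp y ∈ Icc a (fun i => a i + L)},
        ymDensityOfBasis (EuclideanSpace.basisFun _ ℝ) (A t₁) y) =
      -2 * ∫ s in t₁..t₂,
        ∫ y in {y | WithLp.ofLp y ∈ Icc a (fun i => a i + L)},
          ∑ j, ‖divCurvature (A s) y (EuclideanSpace.basisFun _ ℝ j)‖ ^ 2 := by
  set 𝔟 := EuclideanSpace.basisFun (Fin (k + 1)) ℝ with h𝔟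
  set Q : Set (EuclideanSpace ℝ (Fin (k + 1))) :=
    {y | (WithLp.ofLp y : Fin (k + 1) → ℝ) ∈ Icc a (fun i => a i + L)}
    with hQ
  set U : Set (ℝ × (EuclideanSpace ℝ (Fin (k + 1)))) := Ioi (0 : ℝ) ×ˢ univ with hU'
  have hU : IsOpen U := isOpen_Ioi.prod isOpen_univ
  -- the three densities on space-time
  set e : ℝ × (EuclideanSpace ℝ (Fin (k + 1))) → ℝ :=
    fun p => ymDensityOfBasis 𝔟 (A p.1) p.2 with he
  set Pt : ℝ × (EuclideanSpace ℝ (Fin (k + 1))) → ℝ := fun p => ∑ i, ∑ j,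
    fderiv ℝ (fun y => ⟪curvature (A p.1) y (𝔟 i) (𝔟 j),
      fderiv ℝ (fun q : ℝ × _ => A q.1 q.2) (p.1, y) ((1 : ℝ), 0) (𝔟 j)⟫) p.2 (𝔟 i) with hPt
  set Dis : ℝ × (EuclideanSpace ℝ (Fin (k + 1))) → ℝ :=
    fun p => ∑ j, ‖divCurvature (A p.1) p.2 (𝔟 j)‖ ^ 2 with hDis
  set rate : ℝ × (EuclideanSpace ℝ (Fin (k + 1))) → ℝ := fun p => 2 * Pt p - 2 * Dis p with hrate
  -- continuity on positive space-time
  have hrate_c : ContinuousOn rate U := continuousOn_energyRate_of_flow 𝔟 hA hn hval hpde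
  have hPt_c : ContinuousOn Pt U := continuousOn_divergenceTerm_of_flow 𝔟 hA hn hval hpde
  have hDis_c : ContinuousOn Dis U := by
    refine ((hPt_c.sub ((continuousOn_const (c := (2⁻¹ : ℝ))).mul hrate_c))).congr ?_
    intro p _
    simp only [hrate, Pi.sub_apply, Pi.mul_apply]
    ring
  have he_c : ContinuousOn e U := (contDiffOn_ymDensityOfBasis_joint 𝔟 hA hn).continuousOn
  -- the derivative in time, at every point of positive space-time
  have hderiv : ∀ p ∈ U, HasDerivAt (fun s => e (s, p.2)) (rate p) p.1 := by
    rintro ⟨s, y⟩ hp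
    exact hasDerivAt_ymDensityOfBasis_of_flow 𝔟 hA hn hp.1 y (hval hp.1 y) (hpde hp.1 y)
  -- the cell is compact and measurable
  have hQc : IsCompact Q :=
    (PiLp.continuousLinearEquiv 2 ℝ (fun _ : Fin (k + 1) => ℝ)).toHomeomorph.isCompact_preimage.mpr
      isCompact_Icc
  have hQm : MeasurableSet Q := hQc.isClosed.measurableSet
  -- slices in `y` at a fixed positive time, and in `s` at a fixed point, are continuous
  have hslice_y : ∀ {f : ℝ × (EuclideanSpace ℝ (Fin (k + 1))) → ℝ}, ContinuousOn f U →
      ∀ {s : ℝ}, 0 < s →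
      Continuous fun y => f (s, y) := fun hf s hs =>
    continuousOn_univ.mp (hf.comp (continuous_const.prodMk continuous_id).continuousOn
      fun y _ => ⟨hs, mem_univ y⟩)
  have hslice_s : ∀ {f : ℝ × (EuclideanSpace ℝ (Fin (k + 1))) → ℝ}, ContinuousOn f U → ∀ y,
      ContinuousOn (fun s => f (s, y)) (Icc t₁ t₂) := fun hf y =>
    hf.comp (continuous_id.prodMk continuous_const).continuousOn
      fun s hs => ⟨lt_of_lt_of_le ht₁ hs.1, mem_univ y⟩
  -- Step 1: fundamental theorem of calculus in time, pointwise in `y`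
  have hFTC : ∀ y, ∫ s in t₁..t₂, rate (s, y) = e (t₂, y) - e (t₁, y) := by
    intro y
    refine intervalIntegral.integral_eq_sub_of_hasDerivAt (f := fun s => e (s, y))
      (f' := fun s => rate (s, y)) (fun s hs => ?_)
      ((hslice_s hrate_c y).intervalIntegrable_of_Icc h12)
    rw [uIcc_of_le h12] at hs
    exact hderiv (s, y) ⟨lt_of_lt_of_le ht₁ hs.1, mem_univ y⟩
  -- Step 2: integrate over the cell
  have hint_e : ∀ {s : ℝ}, 0 < s → IntegrableOn (fun y => e (s, y)) Q :=
    fun hs => (hslice_y he_c hs).continuousOn.integrableOn_compact hQc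
  have hLHS : (∫ y in Q, e (t₂, y)) - ∫ y in Q, e (t₁, y) =
      ∫ y in Q, ∫ s in t₁..t₂, rate (s, y) := by
    rw [← integral_sub (hint_e (lt_of_lt_of_le ht₁ h12)) (hint_e ht₁)]
    exact setIntegral_congr_fun hQm fun y _ => (hFTC y).symm
  -- Step 3: Fubini on `Q × [t₁, t₂]`
  have hprod_int : Integrable
      (Function.uncurry fun (y : EuclideanSpace ℝ (Fin (k + 1))) (s : ℝ) => rate (s, y))
      ((volume.restrict Q).prod (volume.restrict (Ioc t₁ t₂))) := by
    have hc : ContinuousOn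
        (Function.uncurry fun (y : EuclideanSpace ℝ (Fin (k + 1))) (s : ℝ) => rate (s, y))
        (Q ×ˢ Icc t₁ t₂) := by
      refine hrate_c.comp continuous_swap.continuousOn ?_
      rintro ⟨y, s⟩ ⟨_, hs⟩
      exact ⟨lt_of_lt_of_le ht₁ hs.1, mem_univ y⟩
    have hi : IntegrableOn
        (Function.uncurry fun (y : EuclideanSpace ℝ (Fin (k + 1))) (s : ℝ) => rate (s, y))
        (Q ×ˢ Ioc t₁ t₂) (volume.prod volume) := by
      rw [← Measure.volume_eq_prod]
      exact (hc.integrableOn_compact (hQc.prod isCompact_Icc)).mono_set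
        (prod_mono Subset.rfl Ioc_subset_Icc_self)
    rw [Measure.prod_restrict]
    exact hi
  have hswap : ∫ y in Q, ∫ s in t₁..t₂, rate (s, y) = ∫ s in t₁..t₂, ∫ y in Q, rate (s, y) := by
    simp_rw [intervalIntegral.integral_of_le h12]
    exact integral_integral_swap hprod_int
  -- Step 4: at each time, the divergence term integrates to zero over the cell
  have hinner : ∀ s ∈ Ioc t₁ t₂, ∫ y in Q, rate (s, y) = -2 * ∫ y in Q, Dis (s, y) := by
    intro s hs
    have hs0 : 0 < s := lt_trans ht₁ hs.1
    have hP0 : ∫ y in Q, Pt (s, y) = 0 :=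
      setIntegral_cell_divergenceTerm_eq_zero hL a hA hn hs0 hper (hslice_y hPt_c hs0)
    have hiP : IntegrableOn (fun y => Pt (s, y)) Q :=
      (hslice_y hPt_c hs0).continuousOn.integrableOn_compact hQc
    have hiD : IntegrableOn (fun y => Dis (s, y)) Q :=
      (hslice_y hDis_c hs0).continuousOn.integrableOn_compact hQc
    simp only [hrate]
    rw [integral_sub (hiP.const_mul 2) (hiD.const_mul 2), integral_const_mul, integral_const_mul,
      hP0]
    ring
  have hRHS : ∫ s in t₁..t₂, ∫ y in Q, rate (s, y) = -2 * ∫ s in t₁..t₂, ∫ y in Q, Dis (s, y) := by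
    rw [intervalIntegral.integral_of_le h12, intervalIntegral.integral_of_le h12,
      ← integral_const_mul]
    exact setIntegral_congr_fun measurableSet_Ioc hinner
  -- assemble
  rw [hLHS, hswap, hRHS]

/-- **Energy identity for immortal periodic flow lines.** For a time-dependent `𝔲(N)`-valued
connection on `ℝ^{k+1}`, jointly smooth on positive space-time, `L`-periodic at positive times and
solving the Yang–Mills heat flow in the sense of `IsYangMillsHeatFlow`, the Yang–Mills energy of a
period cell dissipates at rate `2 ∫ |D^* F|²`:
`∫_Q ∑_{i<j}‖F_{ij}(t₂)‖² − ∫_Q ∑_{i<j}‖F_{ij}(t₁)‖² = −2 ∫_{t₁}^{t₂}∫_Q ∑ⱼ ‖(div_A F)_j‖²`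
for `0 < t₁ ≤ t₂`. This is the global energy identity invoked in the proof of Waldron's Cor. 1.2
(hypothesis (1.1) of his Thm. 1.1 on a closed manifold), in the setting of the named fact
`Waldron2019_yangMillsFlow_flatTorus`. [cite: Waldron2019, §2 (2.5) and §1 (1.1)] -/
theorem IsYangMillsHeatFlow.ymEnergy_cell_sub_eq {L : ℝ} (hL : 0 ≤ L) (a : Fin (k + 1) → ℝ)
    {A : ℝ → Connection (EuclideanSpace ℝ (Fin (k + 1))) (Matrix m m ℂ)}
    (hA : ContDiffOn ℝ ∞ (fun p : ℝ × _ => A p.1 p.2) (Ioi (0 : ℝ) ×ˢ univ))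
    (hper : ∀ s : ℝ, 0 < s → (A s).IsLatticePeriodic L)
    (hflow : IsYangMillsHeatFlow (skewAdjoint.submodule ℝ (Matrix m m ℂ)) A)
    {t₁ t₂ : ℝ} (ht₁ : 0 < t₁) (h12 : t₁ ≤ t₂) :
    (∫ y in {y | WithLp.ofLp y ∈ Icc a (fun i => a i + L)},
        ymDensityOfBasis (EuclideanSpace.basisFun _ ℝ) (A t₂) y) -
      (∫ y in {y | WithLp.ofLp y ∈ Icc a (fun i => a i + L)},
        ymDensityOfBasis (EuclideanSpace.basisFun _ ℝ) (A t₁) y) =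
      -2 * ∫ s in t₁..t₂,
        ∫ y in {y | WithLp.ofLp y ∈ Icc a (fun i => a i + L)},
          ∑ j, ‖divCurvature (A s) y (EuclideanSpace.basisFun _ ℝ j)‖ ^ 2 :=
  ymEnergy_cell_sub_eq_of_flow hL a hA (WithTop.coe_le_coe.mpr le_top) hper hflow.isValuedIn
    (fun _ hs y w => hflow.deriv_eq hs y w) ht₁ h12

/-- In particular the Yang–Mills energy of a period cell is non-increasing along the flow
(Waldron 2019 §2; Struwe 1994, §3.2, (12)). [cite: Waldron2019, §2 (2.5)] -/
theorem IsYangMillsHeatFlow.ymEnergy_cell_antitone {L : ℝ} (hL : 0 ≤ L) (a : Fin (k + 1) → ℝ)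
    {A : ℝ → Connection (EuclideanSpace ℝ (Fin (k + 1))) (Matrix m m ℂ)}
    (hA : ContDiffOn ℝ ∞ (fun p : ℝ × _ => A p.1 p.2) (Ioi (0 : ℝ) ×ˢ univ))
    (hper : ∀ s : ℝ, 0 < s → (A s).IsLatticePeriodic L)
    (hflow : IsYangMillsHeatFlow (skewAdjoint.submodule ℝ (Matrix m m ℂ)) A)
    {t₁ t₂ : ℝ} (ht₁ : 0 < t₁) (h12 : t₁ ≤ t₂) :
    (∫ y in {y | WithLp.ofLp y ∈ Icc a (fun i => a i + L)},
        ymDensityOfBasis (EuclideanSpace.basisFun _ ℝ) (A t₂) y) ≤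
      ∫ y in {y | WithLp.ofLp y ∈ Icc a (fun i => a i + L)},
        ymDensityOfBasis (EuclideanSpace.basisFun _ ℝ) (A t₁) y := by
  have h := hflow.ymEnergy_cell_sub_eq hL a hA hper ht₁ h12
  have hnonneg : 0 ≤ ∫ s in t₁..t₂,
      ∫ y in {y | WithLp.ofLp y ∈ Icc a (fun i => a i + L)},
        ∑ j, ‖divCurvature (A s) y (EuclideanSpace.basisFun _ ℝ j)‖ ^ 2 := by
    refine intervalIntegral.integral_nonneg h12 fun s _ => ?_
    exact integral_nonneg fun y => Finset.sum_nonneg fun j _ => by positivity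
  linarith

/-- **The weighted divergence term over a period cell.** With a `C¹` periodic weight `φ`,
`∫_Q φ ∑ᵢⱼ ∂ᵢ⟨F_{ij}, Ȧ_j⟩ = −∫_Q ∑ᵢ (∑ⱼ ⟨F_{ij}, Ȧ_j⟩) ∂ᵢφ` at each positive time (Stokes on
the torus for the periodic field `φ Wᵢ`, `Wᵢ = ∑ⱼ ⟨F_{ij}, Ȧ_j⟩`): the integration by parts
behind Waldron's local energy identity (3.3). [folklore] -/
theorem setIntegral_cell_weighted_divergenceTerm_eq {n : WithTop ℕ∞} {L : ℝ} (hL : 0 ≤ L)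
    (a : Fin (k + 1) → ℝ) {A : ℝ → Connection (EuclideanSpace ℝ (Fin (k + 1))) (Matrix m m ℂ)}
    (hA : ContDiffOn ℝ n (fun p : ℝ × _ => A p.1 p.2) (Ioi (0 : ℝ) ×ˢ univ))
    (hn : 2 ≤ n) {s : ℝ} (hs : 0 < s)
    (hper : ∀ s : ℝ, 0 < s → (A s).IsLatticePeriodic L)
    {φ : EuclideanSpace ℝ (Fin (k + 1)) → ℝ} (hφ : ContDiff ℝ 1 φ)
    (hφper : ∀ y i, φ (y + EuclideanSpace.single i L) = φ y)
    (hcont : Continuous fun y : EuclideanSpace ℝ (Fin (k + 1)) =>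
      ∑ i, ∑ j, fderiv ℝ (fun z => ⟪curvature (A s) z (EuclideanSpace.basisFun _ ℝ i)
          (EuclideanSpace.basisFun _ ℝ j),
        fderiv ℝ (fun q : ℝ × _ => A q.1 q.2) (s, z) ((1 : ℝ), 0)
          (EuclideanSpace.basisFun _ ℝ j)⟫) y (EuclideanSpace.basisFun _ ℝ i)) :
    ∫ y in {y | WithLp.ofLp y ∈ Icc a (fun i => a i + L)},
      φ y * ∑ i, ∑ j, fderiv ℝ (fun z => ⟪curvature (A s) z (EuclideanSpace.basisFun _ ℝ i)
          (EuclideanSpace.basisFun _ ℝ j),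
        fderiv ℝ (fun q : ℝ × _ => A q.1 q.2) (s, z) ((1 : ℝ), 0)
          (EuclideanSpace.basisFun _ ℝ j)⟫) y (EuclideanSpace.basisFun _ ℝ i) =
      -∫ y in {y | WithLp.ofLp y ∈ Icc a (fun i => a i + L)},
        ∑ i, (∑ j, ⟪curvature (A s) y (EuclideanSpace.basisFun _ ℝ i)
            (EuclideanSpace.basisFun _ ℝ j),
          fderiv ℝ (fun q : ℝ × _ => A q.1 q.2) (s, y) ((1 : ℝ), 0)
            (EuclideanSpace.basisFun _ ℝ j)⟫) * fderiv ℝ φ y (EuclideanSpace.basisFun _ ℝ i) := by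
  set 𝔟 := EuclideanSpace.basisFun (Fin (k + 1)) ℝ with h𝔟
  set Q : Set (EuclideanSpace ℝ (Fin (k + 1))) := {y | WithLp.ofLp y ∈ Icc a (fun i => a i + L)}
    with hQ
  have hU : IsOpen (Ioi (0 : ℝ) ×ˢ (univ : Set (EuclideanSpace ℝ (Fin (k + 1))))) :=
    isOpen_Ioi.prod isOpen_univ
  -- the players at time `s`
  set G : EuclideanSpace ℝ (Fin (k + 1)) → EuclideanSpace ℝ (Fin (k + 1)) → Matrix m m ℂ :=
    fun y w => fderiv ℝ (fun q : ℝ × _ => A q.1 q.2) (s, y) ((1 : ℝ), 0) w with hG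
  set Φ : Fin (k + 1) → Fin (k + 1) → EuclideanSpace ℝ (Fin (k + 1)) → ℝ :=
    fun i j y => ⟪curvature (A s) y (𝔟 i) (𝔟 j), G y (𝔟 j)⟫ with hΦ
  have hslice : ContDiff ℝ 2 (A s) := (contDiff_slice_of_contDiffOn hA hs).of_le hn
  have hFd : ∀ i j, Differentiable ℝ fun y => curvature (A s) y (𝔟 i) (𝔟 j) := fun i j =>
    differentiable_curvature_apply hslice _ _
  have hGd : ∀ j, Differentiable ℝ fun y => G y (𝔟 j) := fun j y =>
    (hasFDerivAt_timeDeriv_slice hU hA hn ⟨hs, mem_univ y⟩ (𝔟 j)).differentiableAt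
  have hΦd : ∀ i j, Differentiable ℝ (Φ i j) := fun i j => (hFd i j).inner ℝ (hGd j)
  have hφd : Differentiable ℝ φ := hφ.differentiable one_ne_zero
  -- the weighted vector field `W i = φ * ∑ j Φ i j` and its coordinate version
  set W : EuclideanSpace ℝ (Fin (k + 1)) → Fin (k + 1) → ℝ :=
    fun y i => φ y * ∑ j, Φ i j y with hW
  have hSd : ∀ i, Differentiable ℝ fun y => ∑ j, Φ i j y := fun i =>
    Differentiable.fun_sum fun j _ => hΦd i j
  have hWd : Differentiable ℝ W := differentiable_pi.mpr fun i => hφd.mul (hSd i)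
  set w : (Fin (k + 1) → ℝ) → Fin (k + 1) → ℝ := fun z => W (WithLp.toLp 2 z) with hw
  set eqv := (PiLp.continuousLinearEquiv 2 ℝ (fun _ : Fin (k + 1) => ℝ)).symm with heqv
  have hwd : Differentiable ℝ w := hWd.comp eqv.differentiable
  -- periodicity
  have hperA : ∀ i, ∀ r : ℝ, 0 < r → ∀ y : EuclideanSpace ℝ (Fin (k + 1)),
      A r (y + EuclideanSpace.single i L) = A r y := fun i r hr y => hper r hr y i
  have hΦper : ∀ i j l y, Φ i j (y + EuclideanSpace.single l L) = Φ i j y := by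
    intro i j l y
    simp only [hΦ, hG, curvature_comp_add _ (hperA l s hs)]
    rw [fderiv_joint_comp_add _ (hperA l) hs]
  have hwper : ∀ z l, w (z + Pi.single l L) = w z := by
    intro z l
    simp only [hw, hW, WithLp.toLp_add, PiLp.toLp_single]
    funext i
    rw [hφper, Finset.sum_congr rfl fun j _ => hΦper i j l _]
  -- the divergence of `w`: `φ ∑ᵢⱼ ∂ᵢΦᵢⱼ + ∑ᵢ (∑ⱼ Φᵢⱼ) ∂ᵢφ`
  have hdiv : ∀ z : Fin (k + 1) → ℝ, ∑ i, fderiv ℝ w z (Pi.single i 1) i =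
      φ (WithLp.toLp 2 z) * ∑ i, ∑ j, fderiv ℝ (Φ i j) (WithLp.toLp 2 z) (𝔟 i) +
        ∑ i, (∑ j, Φ i j (WithLp.toLp 2 z)) * fderiv ℝ φ (WithLp.toLp 2 z) (𝔟 i) := by
    intro z
    rw [Finset.mul_sum, ← Finset.sum_add_distrib]
    refine Finset.sum_congr rfl fun i _ => ?_
    have hc : HasFDerivAt (fun z : Fin (k + 1) → ℝ => W (WithLp.toLp 2 z))
        ((fderiv ℝ W (WithLp.toLp 2 z)).comp
          (eqv : (Fin (k + 1) → ℝ) →L[ℝ] (EuclideanSpace ℝ (Fin (k + 1))))) z :=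
      (hWd _).hasFDerivAt.comp z eqv.hasFDerivAt
    have hWi : fderiv ℝ W (WithLp.toLp 2 z) = ContinuousLinearMap.pi fun i =>
        fderiv ℝ (fun y => φ y * ∑ j, Φ i j y) (WithLp.toLp 2 z) :=
      fderiv_pi fun i => (hφd.mul (hSd i)) _
    rw [hw, hc.fderiv, ContinuousLinearMap.comp_apply, hWi, ContinuousLinearMap.pi_apply,
      fderiv_fun_mul (hφd _) (hSd i _), fderiv_fun_sum fun j _ => (hΦd i j _)]
    simp [heqv, h𝔟, EuclideanSpace.basisFun_apply]
  -- integrability of the divergence on the period box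
  have hcS : ∀ i, Continuous fun y => ∑ j, Φ i j y := fun i => (hSd i).continuous
  have hcdiv : Continuous fun z : Fin (k + 1) → ℝ =>
      φ (WithLp.toLp 2 z) * ∑ i, ∑ j, fderiv ℝ (Φ i j) (WithLp.toLp 2 z) (𝔟 i) +
        ∑ i, (∑ j, Φ i j (WithLp.toLp 2 z)) * fderiv ℝ φ (WithLp.toLp 2 z) (𝔟 i) := by
    refine ((hφ.continuous.comp eqv.continuous).mul (hcont.comp eqv.continuous)).add ?_
    refine continuous_finsetSum _ fun i _ => ((hcS i).comp eqv.continuous).mul ?_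
    exact ((hφ.continuous_fderiv one_ne_zero).comp eqv.continuous).clm_apply continuous_const
  have hint : IntegrableOn (fun z => ∑ i, fderiv ℝ w z (Pi.single i 1) i)
      (Icc a (fun i => a i + L)) := by
    rw [show (fun z => ∑ i, fderiv ℝ w z (Pi.single i 1) i) = _ from funext hdiv]
    exact hcdiv.continuousOn.integrableOn_compact isCompact_Icc
  -- Stokes on the torus, in coordinates, and transport back
  have hper0 := Literature.Analysis.Calculus.integral_divergence_eq_zero_of_periodic hL a w
    (fun z => fderiv ℝ w z) hwd.continuous (fun z => (hwd z).hasFDerivAt) hwper hint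
  simp_rw [hdiv] at hper0
  have htrans := (PiLp.volume_preserving_ofLp (Fin (k + 1))).setIntegral_preimage_emb
    (MeasurableEquiv.toLp 2 (Fin (k + 1) → ℝ)).symm.measurableEmbedding
    (fun z => φ (WithLp.toLp 2 z) * ∑ i, ∑ j, fderiv ℝ (Φ i j) (WithLp.toLp 2 z) (𝔟 i) +
        ∑ i, (∑ j, Φ i j (WithLp.toLp 2 z)) * fderiv ℝ φ (WithLp.toLp 2 z) (𝔟 i))
    (Icc a (fun i => a i + L))
  simp only [WithLp.toLp_ofLp] at htrans
  rw [hper0] at htrans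
  -- split the integral of the sum
  have hQc : IsCompact Q :=
    (PiLp.continuousLinearEquiv 2 ℝ (fun _ : Fin (k + 1) => ℝ)).toHomeomorph.isCompact_preimage.mpr
      isCompact_Icc
  have hi1 : IntegrableOn (fun y => φ y * ∑ i, ∑ j, fderiv ℝ (Φ i j) y (𝔟 i)) Q :=
    (hφ.continuous.mul hcont).continuousOn.integrableOn_compact hQc
  have hi2 : IntegrableOn (fun y => ∑ i, (∑ j, Φ i j y) * fderiv ℝ φ y (𝔟 i)) Q := by
    refine Continuous.continuousOn ?_ |>.integrableOn_compact hQc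
    refine continuous_finsetSum _ fun i _ => (hcS i).mul ?_
    exact (hφ.continuous_fderiv one_ne_zero).clm_apply continuous_const
  change ∫ y in Q, φ y * ∑ i, ∑ j, fderiv ℝ (Φ i j) y (𝔟 i) =
    -∫ y in Q, ∑ i, (∑ j, Φ i j y) * fderiv ℝ φ y (𝔟 i)
  have h2 : ∫ y in Q, (φ y * ∑ i, ∑ j, fderiv ℝ (Φ i j) y (𝔟 i) +
      ∑ i, (∑ j, Φ i j y) * fderiv ℝ φ y (𝔟 i)) = 0 := htrans
  rw [integral_add hi1 hi2] at h2
  linarith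

/-- **Local (weighted) energy identity on the flat torus** (Waldron 2019 (3.3), integrated in
time; Waldron (2.5)–(2.6) with a general cut-off). For a classical `L`-periodic `𝔲(N)`-valued
solution of the Yang–Mills heat flow and a `C¹` `L`-periodic weight `φ`, on a period cell `Q` and
for `0 < t₁ ≤ t₂`:
`∫_Q φ ∑_{i<j}‖F_{ij}(t₂)‖² − ∫_Q φ ∑_{i<j}‖F_{ij}(t₁)‖²
   = −2 ∫_{t₁}^{t₂} ∫_Q ( ∑ᵢ (∑ⱼ ⟨F_{ij}, (div_A F)_j⟩) ∂ᵢφ + φ ∑ⱼ ‖(div_A F)_j‖² )`,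
i.e. `½ d/dt ∫ |F|²φ + ∫ |D^*F|²φ + ∫ ⟨D^*F^j, F_{ij} ∇^iφ⟩ = 0` with `D^*F = −div_A F`.
[cite: Waldron2019, §3 (3.3)] -/
theorem ymEnergy_cell_weighted_sub_eq_of_flow {n : WithTop ℕ∞} {L : ℝ} (hL : 0 ≤ L)
    (a : Fin (k + 1) → ℝ) {A : ℝ → Connection (EuclideanSpace ℝ (Fin (k + 1))) (Matrix m m ℂ)}
    (hA : ContDiffOn ℝ n (fun p : ℝ × _ => A p.1 p.2) (Ioi (0 : ℝ) ×ˢ univ))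
    (hn : 2 ≤ n) (hper : ∀ s : ℝ, 0 < s → (A s).IsLatticePeriodic L)
    (hval : ∀ ⦃s : ℝ⦄, 0 < s → (A s).IsValuedIn (skewAdjoint.submodule ℝ (Matrix m m ℂ)))
    (hpde : ∀ ⦃s : ℝ⦄, 0 < s → ∀ y w, deriv (fun s' => A s' y w) s = divCurvature (A s) y w)
    {φ : EuclideanSpace ℝ (Fin (k + 1)) → ℝ} (hφ : ContDiff ℝ 1 φ)
    (hφper : ∀ y i, φ (y + EuclideanSpace.single i L) = φ y)
    {t₁ t₂ : ℝ} (ht₁ : 0 < t₁) (h12 : t₁ ≤ t₂) :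
    (∫ y in {y | WithLp.ofLp y ∈ Icc a (fun i => a i + L)},
        φ y * ymDensityOfBasis (EuclideanSpace.basisFun _ ℝ) (A t₂) y) -
      (∫ y in {y | WithLp.ofLp y ∈ Icc a (fun i => a i + L)},
        φ y * ymDensityOfBasis (EuclideanSpace.basisFun _ ℝ) (A t₁) y) =
      -2 * ∫ s in t₁..t₂, ∫ y in {y | WithLp.ofLp y ∈ Icc a (fun i => a i + L)},
        (∑ i, (∑ j, ⟪curvature (A s) y (EuclideanSpace.basisFun _ ℝ i)
            (EuclideanSpace.basisFun _ ℝ j),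
            divCurvature (A s) y (EuclideanSpace.basisFun _ ℝ j)⟫) *
            fderiv ℝ φ y (EuclideanSpace.basisFun _ ℝ i) +
          φ y * ∑ j, ‖divCurvature (A s) y (EuclideanSpace.basisFun _ ℝ j)‖ ^ 2) := by
  set 𝔟 := EuclideanSpace.basisFun (Fin (k + 1)) ℝ with h𝔟
  set Q : Set (EuclideanSpace ℝ (Fin (k + 1))) :=
    {y | (WithLp.ofLp y : Fin (k + 1) → ℝ) ∈ Icc a (fun i => a i + L)} with hQ
  set U : Set (ℝ × (EuclideanSpace ℝ (Fin (k + 1)))) := Ioi (0 : ℝ) ×ˢ univ with hU'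
  have hU : IsOpen U := isOpen_Ioi.prod isOpen_univ
  have hn0 : n ≠ 0 := by
    rintro rfl
    exact (not_le.mpr (by exact_mod_cast (by norm_num : (0:ℕ) < 2) : (0 : WithTop ℕ∞) < 2)) hn
  -- densities on space-time
  set e : ℝ × (EuclideanSpace ℝ (Fin (k + 1))) → ℝ :=
    fun p => ymDensityOfBasis 𝔟 (A p.1) p.2 with he
  set Pt : ℝ × (EuclideanSpace ℝ (Fin (k + 1))) → ℝ := fun p => ∑ i, ∑ j,
    fderiv ℝ (fun y => ⟪curvature (A p.1) y (𝔟 i) (𝔟 j),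
      fderiv ℝ (fun q : ℝ × _ => A q.1 q.2) (p.1, y) ((1 : ℝ), 0) (𝔟 j)⟫) p.2 (𝔟 i) with hPt
  set Dis : ℝ × (EuclideanSpace ℝ (Fin (k + 1))) → ℝ :=
    fun p => ∑ j, ‖divCurvature (A p.1) p.2 (𝔟 j)‖ ^ 2 with hDis
  set rate : ℝ × (EuclideanSpace ℝ (Fin (k + 1))) → ℝ := fun p => 2 * Pt p - 2 * Dis p with hrate
  set Wd : ℝ × (EuclideanSpace ℝ (Fin (k + 1))) → ℝ := fun p =>
    ∑ i, (∑ j, ⟪curvature (A p.1) p.2 (𝔟 i) (𝔟 j), divCurvature (A p.1) p.2 (𝔟 j)⟫) *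
      fderiv ℝ φ p.2 (𝔟 i) with hWd
  -- continuity on positive space-time
  have hrate_c : ContinuousOn rate U := continuousOn_energyRate_of_flow 𝔟 hA hn hval hpde
  have hPt_c : ContinuousOn Pt U := continuousOn_divergenceTerm_of_flow 𝔟 hA hn hval hpde
  have hDis_c : ContinuousOn Dis U := by
    refine ((hPt_c.sub ((continuousOn_const (c := (2⁻¹ : ℝ))).mul hrate_c))).congr ?_
    intro p _
    simp only [hrate, Pi.sub_apply, Pi.mul_apply]
    ring
  have he_c : ContinuousOn e U := (contDiffOn_ymDensityOfBasis_joint 𝔟 hA hn).continuousOn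
  have hφ_c : ContinuousOn (fun p : ℝ × (EuclideanSpace ℝ (Fin (k + 1))) => φ p.2) U :=
    (hφ.continuous.comp continuous_snd).continuousOn
  have hdφ_c : ∀ i, ContinuousOn
      (fun p : ℝ × (EuclideanSpace ℝ (Fin (k + 1))) => fderiv ℝ φ p.2 (𝔟 i)) U := fun i =>
    (((hφ.continuous_fderiv one_ne_zero).comp continuous_snd).clm_apply
      continuous_const).continuousOn
  have hF_c : ∀ i j, ContinuousOn
      (fun p : ℝ × (EuclideanSpace ℝ (Fin (k + 1))) => curvature (A p.1) p.2 (𝔟 i) (𝔟 j)) U :=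
    fun i j => (contDiffOn_curvature_joint hU hA (m := 1)
      (by rw [one_add_one_eq_two]; exact hn) (𝔟 i) (𝔟 j)).continuousOn
  have hD_c : ∀ j, ContinuousOn
      (fun p : ℝ × (EuclideanSpace ℝ (Fin (k + 1))) => divCurvature (A p.1) p.2 (𝔟 j)) U := by
    intro j
    have h1 := hA.continuousOn_fderiv_of_isOpen hU (ENat.one_le_iff_ne_zero_withTop.mpr hn0)
    refine ((h1.clm_apply (continuousOn_const
      (c := ((1 : ℝ), (0 : EuclideanSpace ℝ (Fin (k + 1))))))).clm_apply
      (continuousOn_const (c := 𝔟 j))).congr ?_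
    rintro ⟨s, y⟩ hp
    exact norm_divCurvature_eq_of_flow hA hn0 hp.1 y (𝔟 j) (hpde hp.1 y (𝔟 j))
  have hWd_c : ContinuousOn Wd U :=
    continuousOn_finsetSum _ fun i _ =>
      (continuousOn_finsetSum _ fun j _ => (hF_c i j).inner (hD_c j)).mul (hdφ_c i)
  -- the weighted rate and its time derivative
  have hderiv : ∀ p ∈ U, HasDerivAt (fun s => φ p.2 * e (s, p.2)) (φ p.2 * rate p) p.1 := by
    rintro ⟨s, y⟩ hp
    exact (hasDerivAt_ymDensityOfBasis_of_flow 𝔟 hA hn hp.1 y (hval hp.1 y) (hpde hp.1 y)).const_mul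
      (φ y)
  -- the cell
  have hQc : IsCompact Q :=
    (PiLp.continuousLinearEquiv 2 ℝ (fun _ : Fin (k + 1) => ℝ)).toHomeomorph.isCompact_preimage.mpr
      isCompact_Icc
  have hQm : MeasurableSet Q := hQc.isClosed.measurableSet
  have hslice_y : ∀ {f : ℝ × (EuclideanSpace ℝ (Fin (k + 1))) → ℝ}, ContinuousOn f U →
      ∀ {s : ℝ}, 0 < s → Continuous fun y => f (s, y) := fun hf s hs =>
    continuousOn_univ.mp (hf.comp (continuous_const.prodMk continuous_id).continuousOn
      fun y _ => ⟨hs, mem_univ y⟩)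
  have hslice_s : ∀ {f : ℝ × (EuclideanSpace ℝ (Fin (k + 1))) → ℝ}, ContinuousOn f U → ∀ y,
      ContinuousOn (fun s => f (s, y)) (Icc t₁ t₂) := fun hf y =>
    hf.comp (continuous_id.prodMk continuous_const).continuousOn
      fun s hs => ⟨lt_of_lt_of_le ht₁ hs.1, mem_univ y⟩
  have hwrate_c : ContinuousOn (fun p => φ p.2 * rate p) U := hφ_c.mul hrate_c
  -- Step 1: FTC in time
  have hFTC : ∀ y, ∫ s in t₁..t₂, φ y * rate (s, y) = φ y * e (t₂, y) - φ y * e (t₁, y) := by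
    intro y
    refine intervalIntegral.integral_eq_sub_of_hasDerivAt (f := fun s => φ y * e (s, y))
      (f' := fun s => φ y * rate (s, y)) (fun s hs => ?_)
      ((hslice_s hwrate_c y).intervalIntegrable_of_Icc h12)
    rw [uIcc_of_le h12] at hs
    exact hderiv (s, y) ⟨lt_of_lt_of_le ht₁ hs.1, mem_univ y⟩
  -- Step 2: integrate over the cell
  have hint_e : ∀ {s : ℝ}, 0 < s → IntegrableOn (fun y => φ y * e (s, y)) Q :=
    fun hs => (hslice_y (hφ_c.mul he_c) hs).continuousOn.integrableOn_compact hQc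
  have hLHS : (∫ y in Q, φ y * e (t₂, y)) - ∫ y in Q, φ y * e (t₁, y) =
      ∫ y in Q, ∫ s in t₁..t₂, φ y * rate (s, y) := by
    rw [← integral_sub (hint_e (lt_of_lt_of_le ht₁ h12)) (hint_e ht₁)]
    exact setIntegral_congr_fun hQm fun y _ => (hFTC y).symm
  -- Step 3: Fubini
  have hprod_int : Integrable
      (Function.uncurry fun (y : EuclideanSpace ℝ (Fin (k + 1))) (s : ℝ) => φ y * rate (s, y))
      ((volume.restrict Q).prod (volume.restrict (Ioc t₁ t₂))) := by
    have hc : ContinuousOn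
        (Function.uncurry fun (y : EuclideanSpace ℝ (Fin (k + 1))) (s : ℝ) => φ y * rate (s, y))
        (Q ×ˢ Icc t₁ t₂) := by
      refine hwrate_c.comp continuous_swap.continuousOn ?_
      rintro ⟨y, s⟩ ⟨_, hs⟩
      exact ⟨lt_of_lt_of_le ht₁ hs.1, mem_univ y⟩
    have hi : IntegrableOn
        (Function.uncurry fun (y : EuclideanSpace ℝ (Fin (k + 1))) (s : ℝ) => φ y * rate (s, y))
        (Q ×ˢ Ioc t₁ t₂) (volume.prod volume) := by
      rw [← Measure.volume_eq_prod]
      exact (hc.integrableOn_compact (hQc.prod isCompact_Icc)).mono_set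
        (prod_mono Subset.rfl Ioc_subset_Icc_self)
    rw [Measure.prod_restrict]
    exact hi
  have hswap : ∫ y in Q, ∫ s in t₁..t₂, φ y * rate (s, y) =
      ∫ s in t₁..t₂, ∫ y in Q, φ y * rate (s, y) := by
    simp_rw [intervalIntegral.integral_of_le h12]
    exact integral_integral_swap hprod_int
  -- Step 4: at each time, integrate the weighted divergence term by parts
  have hinner : ∀ s ∈ Ioc t₁ t₂,
      ∫ y in Q, φ y * rate (s, y) = -2 * ∫ y in Q, (Wd (s, y) + φ y * Dis (s, y)) := by
    intro s hs
    have hs0 : 0 < s := lt_trans ht₁ hs.1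
    -- integrate the weighted divergence term by parts, then rewrite `Ȧ` as `div_A F`
    have hG : ∀ y (j : Fin (k + 1)), fderiv ℝ (fun q : ℝ × _ => A q.1 q.2) (s, y) ((1 : ℝ), 0)
        (EuclideanSpace.basisFun (Fin (k + 1)) ℝ j) =
        divCurvature (A s) y (EuclideanSpace.basisFun (Fin (k + 1)) ℝ j) := fun y j =>
      (norm_divCurvature_eq_of_flow hA hn0 hs0 y _ (hpde hs0 y _)).symm
    have hIBP : ∫ y in Q, φ y * Pt (s, y) = -∫ y in Q, Wd (s, y) := by
      have h := setIntegral_cell_weighted_divergenceTerm_eq hL a hA hn hs0 hper hφ hφper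
        (hslice_y hPt_c hs0)
      conv at h => rhs; simp only [hG]
      exact h
    have hiP : IntegrableOn (fun y => φ y * Pt (s, y)) Q :=
      (hslice_y (hφ_c.mul hPt_c) hs0).continuousOn.integrableOn_compact hQc
    have hiD : IntegrableOn (fun y => φ y * Dis (s, y)) Q :=
      (hslice_y (hφ_c.mul hDis_c) hs0).continuousOn.integrableOn_compact hQc
    have hiW : IntegrableOn (fun y => Wd (s, y)) Q :=
      (hslice_y hWd_c hs0).continuousOn.integrableOn_compact hQc
    have hsplit : ∫ y in Q, φ y * rate (s, y) =
        2 * (∫ y in Q, φ y * Pt (s, y)) - 2 * (∫ y in Q, φ y * Dis (s, y)) := by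
      rw [← integral_const_mul, ← integral_const_mul, ← integral_sub (hiP.const_mul 2)
        (hiD.const_mul 2)]
      refine setIntegral_congr_fun hQm fun y _ => ?_
      simp only [hrate]
      ring
    rw [hsplit, integral_add hiW hiD, hIBP]
    ring
  have hRHS : ∫ s in t₁..t₂, ∫ y in Q, φ y * rate (s, y) =
      -2 * ∫ s in t₁..t₂, ∫ y in Q, (Wd (s, y) + φ y * Dis (s, y)) := by
    rw [intervalIntegral.integral_of_le h12, intervalIntegral.integral_of_le h12,
      ← integral_const_mul]
    exact setIntegral_congr_fun measurableSet_Ioc hinner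
  rw [hLHS, hswap, hRHS]

/-- **Hypothesis (1.1) of Waldron's Thm. 1.1 on the flat torus** ("immediate from the global
energy identity", Waldron 2019 p. 3): along an immortal periodic flow line the space-time
dissipation is bounded by the initial energy of a period cell,
`2 ∫_{t₁}^{t₂} ∫_Q ∑ⱼ ‖(div_A F)_j‖² ≤ ∫_Q ∑_{i<j} ‖F_{ij}(t₁)‖²` for all `0 < t₁ ≤ t₂`
(uniformly in `t₂`), while the energy itself is non-increasing
(`IsYangMillsHeatFlow.ymEnergy_cell_antitone`). [cite: Waldron2019, §1 (1.1) and §2 (2.5)] -/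
theorem IsYangMillsHeatFlow.dissipation_le_ymEnergy_cell {L : ℝ} (hL : 0 ≤ L)
    (a : Fin (k + 1) → ℝ)
    {A : ℝ → Connection (EuclideanSpace ℝ (Fin (k + 1))) (Matrix m m ℂ)}
    (hA : ContDiffOn ℝ ∞ (fun p : ℝ × _ => A p.1 p.2) (Ioi (0 : ℝ) ×ˢ univ))
    (hper : ∀ s : ℝ, 0 < s → (A s).IsLatticePeriodic L)
    (hflow : IsYangMillsHeatFlow (skewAdjoint.submodule ℝ (Matrix m m ℂ)) A)
    {t₁ t₂ : ℝ} (ht₁ : 0 < t₁) (h12 : t₁ ≤ t₂) :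
    2 * ∫ s in t₁..t₂, ∫ y in {y | WithLp.ofLp y ∈ Icc a (fun i => a i + L)},
        ∑ j, ‖divCurvature (A s) y (EuclideanSpace.basisFun _ ℝ j)‖ ^ 2 ≤
      ∫ y in {y | WithLp.ofLp y ∈ Icc a (fun i => a i + L)},
        ymDensityOfBasis (EuclideanSpace.basisFun _ ℝ) (A t₁) y := by
  have h := hflow.ymEnergy_cell_sub_eq hL a hA hper ht₁ h12
  have hnonneg : 0 ≤ ∫ y in {y | WithLp.ofLp y ∈ Icc a (fun i => a i + L)},
      ymDensityOfBasis (EuclideanSpace.basisFun _ ℝ) (A t₂) y :=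
    integral_nonneg fun y => ymDensityOfBasis_nonneg _ _ _
  linarith

end TorusEnergy

end Literature.MathematicalPhysics.QuantumLattice
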